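import Summits.AtomisticToContinuum.HydrodynamicLimit.Theorems.ImplosionDichotomyTypeOneRateTools

/-!
# Rate clauses of the periodic Type-I implosion

Helper file for the support item `TypeOneIdealImplosion` (stmt-AtomisticToContinuum-15146) of the
route `ImplosionDichotomy` (`AtomisticToContinuum/HydrodynamicLimit`), companion of
`…TypeOneRateTools`. For a torus field `(ρ₁, u₁)` on `[0, T) × 𝕋³` which is, near every point
whose centred representative `y₀ = reprc x` has `|y₀| < 1/8`, the exact self-similar solution
`E = (ρ_E, u_E)` of the monatomic gas with blow-up time `T` read through the covering map, and near
every other point a smooth exterior field `(ρ_τ, u_τ)` (the local structure produced by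
`…TypeOneGlue`), this file proves the four RATE clauses of
`Literature.Analysis.FluidPDE.CaolaboraEtAl2025_thm12_rates`:

* `glue_typeI` — Type-I bounds `‖∂ᵢu₁‖, |∂ᵢρ₁^{1/3}| ≤ C/(T−t)` (core: the Type-I identities of
  the exact solution, `typeI_of_profile`; exterior: bounded derivatives, `≤ M ≤ MT/(T−t)`);
* `glue_iteratedFDeriv_le` — `‖Dⁿ lift ρ₁(t)‖, ‖Dⁿ lift u₁(t)‖ ≤ Cₙ(T−t)^{−pₙ}`, `pₙ = 3 − 3/r + n/r`,
  for EVERY `n` (core: exact scaling `Dⁿ[g(e·)] = eⁿ(Dⁿg)(e·)`, `e = (T−t)^{−1/r}`, and the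
  bounded profile derivatives `exists_bound_iteratedFDeriv_profile`; exterior: bounded);
* `glue_floor` — `ρ₁ ≥ c_l > 0` (core: `σ = r⁻¹(T−t)^{1/r−1}S(ζ) ≥ min(r⁻¹T^{1/r−1} min_{[0,1]}S,
  r⁻¹ min_{[0,1]}B)` by the far-field representation `S = ζ^{1−r}B(ζ^{−r})`; exterior: positive
  minimum);
* `glue_core_law` — at the core `ρ₁(t, proj 0) = (S(0)/(3r))³(T−t)^{−3(1−1/r)}` exactly.
-/

noncomputable section

namespace Summit.AtomisticToContinuum.HydrodynamicLimit.Theorems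

open Set Filter Topology Metric Function
open scoped ContDiff
open Literature.MathematicalPhysics.KineticTheory
open Literature.Analysis.FunctionSpaces Literature.Analysis.FunctionSpaces.Torus
open Literature.Analysis.FluidPDE.CaolaboraEtAl2025
open Literature.Analysis.FluidPDE.IsentropicEuler (partialDeriv_proj_eq)

section Rates

variable {r T : ℝ} {U S A B : ℝ → ℝ} {ρ₁ ρτ : ℝ → T3 → ℝ} {u₁ uτ : ℝ → T3 → V3}

/-- Powers of `T − t` in the rate clauses: for `0 ≤ t < T ≤ 1`, `T − t ∈ (0, 1]`. [folklore] -/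
theorem sub_mem_Ioc_one (hT1 : T ≤ 1) {t : ℝ} (ht : t ∈ Ico 0 T) : T - t ∈ Ioc (0 : ℝ) 1 :=
  ⟨sub_pos.2 ht.2, by linarith [ht.1]⟩

/-- **Type-I clause.** [cite: CaolaboraEtAl2025, Lemma 3.6 p. 26 (Type I); §1.3 p. 5] -/
theorem glue_typeI (hr : 0 < r)
    (hU : ContDiff ℝ ∞ fun y : V3 => (U ‖y‖ / ‖y‖) • y) (hS : ContDiff ℝ ∞ fun y : V3 => S ‖y‖)
    (hode : ∀ ζ : ℝ, 0 < ζ →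
      (r - 1) * U ζ + (ζ + U ζ) * deriv U ζ + 1 / 3 * S ζ * deriv S ζ = 0 ∧
      (r - 1) * S ζ + (ζ + U ζ) * deriv S ζ + 1 / 3 * S ζ * (deriv U ζ + 2 * U ζ / ζ) = 0)
    (hSpos : ∀ ζ : ℝ, 0 ≤ ζ → 0 < S ζ)
    (hlimU : Tendsto (fun ζ => U ζ / ζ) atTop (𝓝 0))
    (hlimS : Tendsto (fun ζ => S ζ / ζ) atTop (𝓝 0))
    (hρ₁s : ∀ t ∈ Ico 0 T, IsSmooth (ρ₁ t)) (hu₁s : ∀ t ∈ Ico 0 T, IsSmooth (u₁ t))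
    (hρ₁pos : ∀ t ∈ Ico 0 T, ∀ x, 0 < ρ₁ t x)
    (hτρs : ∀ t ∈ Ico 0 T, IsSmooth (ρτ t)) (hτus : ∀ t ∈ Ico 0 T, IsSmooth (uτ t))
    (hτpos : ∀ t ∈ Ico 0 T, ∀ x, 0 < ρτ t x)
    (hcoreρ : ∀ x : T3, ‖reprc x‖ < 1 / 8 → ∀ t ∈ Ico 0 T,
      lift (ρ₁ t) =ᶠ[𝓝 (reprc x)] fun z =>
        (r⁻¹ * (T - t) ^ (1 / r - 1) * S ‖(T - t) ^ (-1 / r) • z‖ / 3) ^ 3)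
    (hcoreu : ∀ x : T3, ‖reprc x‖ < 1 / 8 → ∀ t ∈ Ico 0 T,
      lift (u₁ t) =ᶠ[𝓝 (reprc x)] fun z => (r⁻¹ * (T - t) ^ (1 / r - 1)) •
        ((U ‖(T - t) ^ (-1 / r) • z‖ / ‖(T - t) ^ (-1 / r) • z‖) • ((T - t) ^ (-1 / r) • z)))
    (hextρ : ∀ x : T3, 1 / 8 ≤ ‖reprc x‖ → ∀ t ∈ Ico 0 T, lift (ρ₁ t) =ᶠ[𝓝 (reprc x)] lift (ρτ t))
    (hextu : ∀ x : T3, 1 / 8 ≤ ‖reprc x‖ → ∀ t ∈ Ico 0 T, lift (u₁ t) =ᶠ[𝓝 (reprc x)] lift (uτ t))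
    {M : ℝ} (hM : ∀ t ∈ Ico 0 T, ∀ x (i : Fin 3), ‖partialDeriv i (uτ t) x‖ ≤ M ∧
      |partialDeriv i (fun y => ρτ t y ^ (1 / 3 : ℝ)) x| ≤ M) :
    ∃ C : ℝ, ∀ t ∈ Ico 0 T, ∀ x (i : Fin 3),
      ‖partialDeriv i (u₁ t) x‖ ≤ C / (T - t) ∧
        |partialDeriv i (fun y => ρ₁ t y ^ (1 / 3 : ℝ)) x| ≤ C / (T - t) := by
  -- the exact solution and its Type-I bounds
  set Ub : V3 → V3 := fun y => (U ‖y‖ / ‖y‖) • y with hUb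
  set Sb : V3 → ℝ := fun y => S ‖y‖ with hSb
  set uE : ℝ → V3 → V3 := fun t x => (r⁻¹ * (T - t) ^ (1 / r - 1)) • Ub ((T - t) ^ (-1 / r) • x)
    with huE
  set σE : ℝ → V3 → ℝ := fun t x => (r⁻¹ * (T - t) ^ (1 / r - 1)) * Sb ((T - t) ^ (-1 / r) • x)
    with hσE
  set ρE : ℝ → V3 → ℝ := fun t x => (σE t x / 3) ^ 3 with hρE
  obtain ⟨CE, hCE⟩ := typeI_of_profile (T := T) (u := uE) (σ := σE) (ρ := ρE)
    hr hU hS hode hSpos hlimU hlimS hUb hSb (fun _ _ => rfl) (fun _ _ => rfl) (fun _ _ => rfl)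
  refine ⟨max CE (max M 0 * T), fun t ht x i => ?_⟩
  have hTt : 0 < T - t := sub_pos.2 ht.2
  have hCE' : CE / (T - t) ≤ max CE (max M 0 * T) / (T - t) :=
    div_le_div_of_nonneg_right (le_max_left _ _) hTt.le
  have hM' : M ≤ max CE (max M 0 * T) / (T - t) := by
    have h1 : max M 0 ≤ max M 0 * T / (T - t) := by
      rw [le_div_iff₀ hTt]; nlinarith [le_max_right M 0, ht.1]
    exact (le_max_left _ _).trans (h1.trans (div_le_div_of_nonneg_right (le_max_right _ _) hTt.le))
  have hρ₁1 : IsContDiff 1 (ρ₁ t) := (hρ₁s t ht).of_le (mod_cast le_top)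
  have hu₁1 : IsContDiff 1 (u₁ t) := (hu₁s t ht).of_le (mod_cast le_top)
  have hcb : IsContDiff 1 (fun y => ρ₁ t y ^ (1 / 3 : ℝ)) := by
    have h : IsSmooth (fun y => ρ₁ t y ^ (1 / 3 : ℝ)) := by
      change ContDiff ℝ ∞ fun z => ρ₁ t (proj z) ^ (1 / 3 : ℝ)
      exact (hρ₁s t ht).rpow_const_of_ne fun z => (hρ₁pos t ht _).ne'
    exact h.of_le (mod_cast le_top)
  obtain ⟨y, rfl⟩ : ∃ y : V3, proj y = x := ⟨reprc x, proj_reprc x⟩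
  by_cases hx : ‖reprc (proj y)‖ < 1 / 8
  · -- core: the Type-I identities of the exact solution
    set y₀ := reprc (proj y) with hy₀
    have hx' : proj y = proj y₀ := by rw [hy₀, proj_reprc]
    have hρl := hcoreρ (proj y) hx t ht
    have hul := hcoreu (proj y) hx t ht
    obtain ⟨hTu, hTρ⟩ := hCE t ht.2 y₀ i
    rw [hx']
    refine ⟨?_, ?_⟩
    · rw [partialDeriv_proj_eq hu₁1, hul.fderiv_eq]
      exact hTu.trans hCE'
    · rw [partialDeriv_proj_eq hcb]
      have hev : lift (fun y => ρ₁ t y ^ (1 / 3 : ℝ)) =ᶠ[𝓝 y₀] fun z => ρE t z ^ (1 / 3 : ℝ) := by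
        filter_upwards [hρl] with z hz
        simp only [lift_apply] at hz ⊢
        rw [hz]
      rw [hev.fderiv_eq]
      exact hTρ.trans hCE'
  · -- exterior: bounded derivatives
    set y₀ := reprc (proj y) with hy₀
    have hx' : proj y = proj y₀ := by rw [hy₀, proj_reprc]
    have hρl := hextρ (proj y) (not_lt.1 hx) t ht
    have hul := hextu (proj y) (not_lt.1 hx) t ht
    have hτu1 : IsContDiff 1 (uτ t) := (hτus t ht).of_le (mod_cast le_top)
    have hτcb : IsContDiff 1 (fun y => ρτ t y ^ (1 / 3 : ℝ)) := by
      have h : IsSmooth (fun y => ρτ t y ^ (1 / 3 : ℝ)) := by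
        change ContDiff ℝ ∞ fun z => ρτ t (proj z) ^ (1 / 3 : ℝ)
        exact (hτρs t ht).rpow_const_of_ne fun z => (hτpos t ht _).ne'
      exact h.of_le (mod_cast le_top)
    obtain ⟨hMu, hMρ⟩ := hM t ht (proj y₀) i
    rw [hx']
    refine ⟨?_, ?_⟩
    · rw [partialDeriv_proj_eq hu₁1, hul.fderiv_eq, ← partialDeriv_proj_eq hτu1]
      exact hMu.trans hM'
    · have hev : lift (fun y => ρ₁ t y ^ (1 / 3 : ℝ)) =ᶠ[𝓝 y₀] lift (fun y => ρτ t y ^ (1 / 3 : ℝ)) := by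
        filter_upwards [hρl] with z hz
        simp only [lift_apply] at hz ⊢
        rw [hz]
      rw [partialDeriv_proj_eq hcb, hev.fderiv_eq, ← partialDeriv_proj_eq hτcb]
      exact hMρ.trans hM'

/-- Exponent bookkeeping of the self-similar scaling: for `λ = T − t > 0`,
`|r⁻¹λ^{1/r−1}| |λ^{−1/r}|ⁿ = r⁻¹ λ^{−(1 − 1/r + n/r)}` and
`|(r⁻¹λ^{1/r−1}/3)³| |λ^{−1/r}|ⁿ = (r⁻¹/3)³ λ^{−(3 − 3/r + n/r)}`. [folklore] -/
theorem scaling_exponents {l : ℝ} (hl : 0 < l) (hr : 0 < r) (n : ℕ) :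
    |r⁻¹ * l ^ (1 / r - 1)| * |l ^ (-1 / r)| ^ n = r⁻¹ * l ^ (-(1 - 1 / r + n / r)) ∧
      |(r⁻¹ * l ^ (1 / r - 1) / 3) ^ 3| * |l ^ (-1 / r)| ^ n =
        (r⁻¹ / 3) ^ 3 * l ^ (-(3 - 3 / r + n / r)) := by
  have ha : 0 < l ^ (1 / r - 1) := Real.rpow_pos_of_pos hl _
  have he : 0 < l ^ (-1 / r) := Real.rpow_pos_of_pos hl _
  have hen : (l ^ (-1 / r)) ^ n = l ^ (-1 / r * n) := by
    rw [← Real.rpow_natCast, ← Real.rpow_mul hl.le]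
  constructor
  · rw [abs_of_pos (mul_pos (inv_pos.2 hr) ha), abs_of_pos he, hen, mul_assoc, ← Real.rpow_add hl]
    congr 2; ring
  · have h3 : (l ^ (1 / r - 1)) ^ 3 = l ^ ((1 / r - 1) * 3) := by
      rw [← Real.rpow_natCast, ← Real.rpow_mul hl.le]; norm_num
    rw [abs_of_pos (pow_pos (div_pos (mul_pos (inv_pos.2 hr) ha) three_pos) 3), abs_of_pos he, hen,
      show (r⁻¹ * l ^ (1 / r - 1) / 3) ^ 3 = (r⁻¹ / 3) ^ 3 * (l ^ (1 / r - 1)) ^ 3 by ring, h3,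
      mul_assoc, ← Real.rpow_add hl]
    congr 2; ring

/-- **Polynomial bounds on all derivatives.** [cite: CaolaboraEtAl2025, Lemma 3.7 p. 27; (1.6) p. 6] -/
theorem glue_iteratedFDeriv_le (hr1 : 1 < r) (hr2 : r < 2)
    (hU : ContDiff ℝ ∞ fun y : V3 => (U ‖y‖ / ‖y‖) • y) (hS : ContDiff ℝ ∞ fun y : V3 => S ‖y‖)
    (hode : ∀ ζ : ℝ, 0 < ζ →
      (r - 1) * U ζ + (ζ + U ζ) * deriv U ζ + 1 / 3 * S ζ * deriv S ζ = 0 ∧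
      (r - 1) * S ζ + (ζ + U ζ) * deriv S ζ + 1 / 3 * S ζ * (deriv U ζ + 2 * U ζ / ζ) = 0)
    (hSpos : ∀ ζ : ℝ, 0 ≤ ζ → 0 < S ζ)
    (hlimU : Tendsto (fun ζ => U ζ / ζ) atTop (𝓝 0))
    (hlimS : Tendsto (fun ζ => S ζ / ζ) atTop (𝓝 0)) (hT1 : T ≤ 1)
    (hcoreρ : ∀ x : T3, ‖reprc x‖ < 1 / 8 → ∀ t ∈ Ico 0 T,
      lift (ρ₁ t) =ᶠ[𝓝 (reprc x)] fun z =>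
        (r⁻¹ * (T - t) ^ (1 / r - 1) * S ‖(T - t) ^ (-1 / r) • z‖ / 3) ^ 3)
    (hcoreu : ∀ x : T3, ‖reprc x‖ < 1 / 8 → ∀ t ∈ Ico 0 T,
      lift (u₁ t) =ᶠ[𝓝 (reprc x)] fun z => (r⁻¹ * (T - t) ^ (1 / r - 1)) •
        ((U ‖(T - t) ^ (-1 / r) • z‖ / ‖(T - t) ^ (-1 / r) • z‖) • ((T - t) ^ (-1 / r) • z)))
    (hextρ : ∀ x : T3, 1 / 8 ≤ ‖reprc x‖ → ∀ t ∈ Ico 0 T, lift (ρ₁ t) =ᶠ[𝓝 (reprc x)] lift (ρτ t))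
    (hextu : ∀ x : T3, 1 / 8 ≤ ‖reprc x‖ → ∀ t ∈ Ico 0 T, lift (u₁ t) =ᶠ[𝓝 (reprc x)] lift (uτ t))
    (n : ℕ) {Mn : ℝ} (hMn : ∀ t ∈ Ico 0 T, ∀ y : V3,
      ‖iteratedFDeriv ℝ n (lift (ρτ t)) y‖ ≤ Mn ∧ ‖iteratedFDeriv ℝ n (lift (uτ t)) y‖ ≤ Mn) :
    ∃ Cn pn : ℝ, ∀ t ∈ Ico 0 T, ∀ y : V3,
      ‖iteratedFDeriv ℝ n (lift (ρ₁ t)) y‖ ≤ Cn * (T - t) ^ (-pn) ∧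
        ‖iteratedFDeriv ℝ n (lift (u₁ t)) y‖ ≤ Cn * (T - t) ^ (-pn) := by
  have hr : 0 < r := by linarith
  obtain ⟨Mp, hMp⟩ := exists_bound_iteratedFDeriv_profile hr1 hr2 hU hS hode hSpos hlimU hlimS n
  have hMp0 : 0 ≤ Mp := (norm_nonneg _).trans (hMp 0).1
  set pn : ℝ := 3 - 3 / r + n / r with hpn
  set qn : ℝ := 1 - 1 / r + n / r with hqn
  have h3 : 3 / r ≤ 3 := by rw [div_le_iff₀ hr]; linarith
  have h2 : 2 / r ≤ 2 := by rw [div_le_iff₀ hr]; linarith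
  have hnr : 0 ≤ (n : ℝ) / r := by positivity
  have hpn0 : 0 ≤ pn := by rw [hpn]; linarith
  have hqp : qn ≤ pn := by
    rw [hpn, hqn]
    have : 3 / r - 1 / r = 2 / r := by ring
    linarith
  set Kρ : ℝ := (r⁻¹ / 3) ^ 3 * Mp with hKρ
  set Ku : ℝ := r⁻¹ * Mp with hKu
  refine ⟨max (max Kρ Ku) (max Mn 0), pn, fun t ht y => ?_⟩
  obtain ⟨hl, hl1⟩ := sub_mem_Ioc_one hT1 ht
  -- monotonicity in the exponent and the constant
  have hmono : (T - t) ^ (-qn) ≤ (T - t) ^ (-pn) :=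
    Real.rpow_le_rpow_of_exponent_ge hl hl1 (neg_le_neg hqp)
  have hone : 1 ≤ (T - t) ^ (-pn) := Real.one_le_rpow_of_pos_of_le_one_of_nonpos hl hl1 (neg_nonpos.2 hpn0)
  have hpow0 : 0 ≤ (T - t) ^ (-pn) := zero_le_one.trans hone
  have hC1 : Kρ * (T - t) ^ (-pn) ≤ max (max Kρ Ku) (max Mn 0) * (T - t) ^ (-pn) :=
    mul_le_mul_of_nonneg_right ((le_max_left _ _).trans (le_max_left _ _)) hpow0
  have hC2 : Ku * (T - t) ^ (-qn) ≤ max (max Kρ Ku) (max Mn 0) * (T - t) ^ (-pn) :=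
    (mul_le_mul_of_nonneg_left hmono (by positivity)).trans
      (mul_le_mul_of_nonneg_right ((le_max_right _ _).trans (le_max_left _ _)) hpow0)
  have hC3 : Mn ≤ max (max Kρ Ku) (max Mn 0) * (T - t) ^ (-pn) :=
    calc Mn ≤ max Mn 0 * 1 := by rw [mul_one]; exact le_max_left _ _
      _ ≤ max (max Kρ Ku) (max Mn 0) * (T - t) ^ (-pn) :=
          mul_le_mul (le_max_right _ _) hone zero_le_one (by positivity)
  -- evaluate at the centred representative
  rw [iteratedFDeriv_lift_eq_reprc (ρ₁ t), iteratedFDeriv_lift_eq_reprc (u₁ t)]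
  set y₀ : V3 := reprc (proj y) with hy₀
  obtain ⟨he1, he2⟩ := scaling_exponents hl hr n
  by_cases hx : ‖reprc (proj y)‖ < 1 / 8
  · -- core: exact scaling
    have hρl := hcoreρ (proj y) hx t ht
    have hul := hcoreu (proj y) hx t ht
    rw [(hρl.iteratedFDeriv ℝ n).eq_of_nhds, (hul.iteratedFDeriv ℝ n).eq_of_nhds]
    refine ⟨?_, ?_⟩
    · -- `ρ_E(t) = (a/3)³ · S̄³(e ·)`
      have hfun : (fun z : V3 => (r⁻¹ * (T - t) ^ (1 / r - 1) * S ‖(T - t) ^ (-1 / r) • z‖ / 3) ^ 3) =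
          fun z => (r⁻¹ * (T - t) ^ (1 / r - 1) / 3) ^ 3 • (fun w : V3 => S ‖w‖ ^ 3) ((T - t) ^ (-1 / r) • z) := by
        funext z; simp only [smul_eq_mul]; ring
      rw [hfun]
      refine (norm_iteratedFDeriv_smul_comp_smul_le (hS.pow 3) (fun z => (hMp z).2.2) _ _ _).trans ?_
      rw [he2]
      calc (r⁻¹ / 3) ^ 3 * (T - t) ^ (-(3 - 3 / r + n / r)) * Mp = Kρ * (T - t) ^ (-pn) := by
            rw [hKρ, hpn]; ring
        _ ≤ _ := hC1
    · refine (norm_iteratedFDeriv_smul_comp_smul_le hU (fun z => (hMp z).1) _ _ _).trans ?_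
      rw [he1]
      calc r⁻¹ * (T - t) ^ (-(1 - 1 / r + n / r)) * Mp = Ku * (T - t) ^ (-qn) := by
            rw [hKu, hqn]; ring
        _ ≤ _ := hC2
  · -- exterior: bounded derivatives
    have hρl := hextρ (proj y) (not_lt.1 hx) t ht
    have hul := hextu (proj y) (not_lt.1 hx) t ht
    rw [(hρl.iteratedFDeriv ℝ n).eq_of_nhds, (hul.iteratedFDeriv ℝ n).eq_of_nhds]
    exact ⟨(hMn t ht y₀).1.trans hC3, (hMn t ht y₀).2.trans hC3⟩

/-- **Density floor.** [cite: CaolaboraEtAl2025, Lemma 3.5 p. 25] -/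
theorem glue_floor (hr1 : 1 < r)
    (hSrep : ∀ ζ : ℝ, 0 < ζ → S ζ = ζ ^ (1 - r) * B (ζ ^ (-r)))
    {mS mB : ℝ} (hmS0 : 0 < mS) (hmS : ∀ ζ ∈ Icc (0 : ℝ) 1, mS ≤ S ζ) (hmB0 : 0 < mB)
    (hmB : ∀ τ ∈ Icc (0 : ℝ) 1, mB ≤ B τ) (hT : 0 < T)
    (hcoreρ : ∀ x : T3, ‖reprc x‖ < 1 / 8 → ∀ t ∈ Ico 0 T,
      lift (ρ₁ t) =ᶠ[𝓝 (reprc x)] fun z =>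
        (r⁻¹ * (T - t) ^ (1 / r - 1) * S ‖(T - t) ^ (-1 / r) • z‖ / 3) ^ 3)
    (hextρ : ∀ x : T3, 1 / 8 ≤ ‖reprc x‖ → ∀ t ∈ Ico 0 T, lift (ρ₁ t) =ᶠ[𝓝 (reprc x)] lift (ρτ t))
    {cτ : ℝ} (hcτ0 : 0 < cτ) (hcτ : ∀ t ∈ Ico 0 T, ∀ x, cτ ≤ ρτ t x) :
    ∃ cl pl : ℝ, 0 < cl ∧ ∀ t ∈ Ico 0 T, ∀ x, cl * (T - t) ^ pl ≤ ρ₁ t x := by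
  have hr : 0 < r := by linarith
  set σm : ℝ := min (r⁻¹ * T ^ (1 / r - 1) * mS) (r⁻¹ * mB) with hσm
  have hσm0 : 0 < σm := lt_min (by positivity) (by positivity)
  refine ⟨min ((σm / 3) ^ 3) cτ, 0, lt_min (by positivity) hcτ0, fun t ht x => ?_⟩
  rw [Real.rpow_zero, mul_one]
  have hl : 0 < T - t := sub_pos.2 ht.2
  by_cases hx : ‖reprc x‖ < 1 / 8
  · have hval : ρ₁ t x = (r⁻¹ * (T - t) ^ (1 / r - 1) * S ‖(T - t) ^ (-1 / r) • reprc x‖ / 3) ^ 3 := by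
      have h := (hcoreρ x hx t ht).self_of_nhds
      rwa [lift_apply, proj_reprc] at h
    rw [hval]
    refine (min_le_left _ _).trans ?_
    -- `σ ≥ σm`
    set y₀ := reprc x with hy₀
    set e : ℝ := (T - t) ^ (-1 / r) with he
    have he0 : 0 < e := Real.rpow_pos_of_pos hl _
    set ζ : ℝ := ‖e • y₀‖ with hζ
    have hζ' : ζ = e * ‖y₀‖ := by rw [hζ, norm_smul, Real.norm_of_nonneg he0.le]
    have hζ0 : 0 ≤ ζ := norm_nonneg _
    have hσ : σm ≤ r⁻¹ * (T - t) ^ (1 / r - 1) * S ζ := by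
      by_cases hζ1 : ζ ≤ 1
      · -- near field: `S ≥ mS`, `(T - t)^{1/r-1} ≥ T^{1/r-1}`
        have h1 : mS ≤ S ζ := hmS ζ ⟨hζ0, hζ1⟩
        have h2 : T ^ (1 / r - 1) ≤ (T - t) ^ (1 / r - 1) :=
          Real.rpow_le_rpow_of_nonpos hl (by linarith [ht.1])
            (by have := (div_lt_one hr).2 hr1; linarith)
        calc σm ≤ r⁻¹ * T ^ (1 / r - 1) * mS := min_le_left _ _
          _ ≤ r⁻¹ * (T - t) ^ (1 / r - 1) * S ζ := by
              have := Real.rpow_pos_of_pos hT (1 / r - 1)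
              gcongr
      · -- far field: `S = ζ^{1-r} B(ζ^{-r})`, `B ≥ mB`
        have hζ1' : 1 ≤ ζ := (not_le.1 hζ1).le
        have hζp : 0 < ζ := by linarith
        have hy0 : 0 < ‖y₀‖ := by
          rcases (norm_nonneg y₀).eq_or_lt with h | h
          · rw [hζ', ← h, mul_zero] at hζp; exact absurd hζp (lt_irrefl 0)
          · exact h
        have hy1 : ‖y₀‖ ≤ 1 := by linarith [show ‖y₀‖ < 1 / 8 from hx]
        have hB1 : mB ≤ B (ζ ^ (-r)) :=
          hmB _ ⟨Real.rpow_nonneg hζ0 _, Real.rpow_le_one_of_one_le_of_nonpos hζ1' (by linarith)⟩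
        have hscale : (T - t) ^ (1 / r - 1) * ζ ^ (1 - r) = ‖y₀‖ ^ (1 - r) := by
          rw [hζ', Real.mul_rpow he0.le (norm_nonneg _), he, ← Real.rpow_mul hl.le, ← mul_assoc,
            ← Real.rpow_add hl]
          have : 1 / r - 1 + -1 / r * (1 - r) = 0 := by field_simp; ring
          rw [this, Real.rpow_zero, one_mul]
        have hy1r : 1 ≤ ‖y₀‖ ^ (1 - r) := Real.one_le_rpow_of_pos_of_le_one_of_nonpos hy0 hy1 (by linarith)
        rw [hSrep ζ hζp]
        calc σm ≤ r⁻¹ * mB := min_le_right _ _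
          _ ≤ r⁻¹ * (‖y₀‖ ^ (1 - r) * B (ζ ^ (-r))) := by
              refine mul_le_mul_of_nonneg_left ?_ (inv_pos.2 hr).le
              calc mB = 1 * mB := (one_mul _).symm
                _ ≤ ‖y₀‖ ^ (1 - r) * B (ζ ^ (-r)) := mul_le_mul hy1r hB1 hmB0.le (by positivity)
          _ = r⁻¹ * (T - t) ^ (1 / r - 1) * (ζ ^ (1 - r) * B (ζ ^ (-r))) := by
              rw [← hscale]; ring
    calc (σm / 3) ^ 3 ≤ (r⁻¹ * (T - t) ^ (1 / r - 1) * S ζ / 3) ^ 3 := by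
          gcongr
      _ = _ := by rw [hζ]
  · have hval : ρ₁ t x = ρτ t x := by
      have h := (hextρ x (not_lt.1 hx) t ht).self_of_nhds
      rwa [lift_apply, lift_apply, proj_reprc] at h
    rw [hval]
    exact (min_le_right _ _).trans (hcτ t ht x)

/-- **Exact core law**: at `proj 0` the glued density is the central density of the exact solution,
`(S(0)/(3r))³ (T−t)^{−3(1−1/r)}`. [cite: CaolaboraEtAl2025, Thm 1.2 at `y = 0`] -/
theorem glue_core_law (hr : 0 < r)
    (hcoreρ : ∀ x : T3, ‖reprc x‖ < 1 / 8 → ∀ t ∈ Ico 0 T,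
      lift (ρ₁ t) =ᶠ[𝓝 (reprc x)] fun z =>
        (r⁻¹ * (T - t) ^ (1 / r - 1) * S ‖(T - t) ^ (-1 / r) • z‖ / 3) ^ 3)
    {t : ℝ} (ht : t ∈ Ico 0 T) :
    ρ₁ t (proj 0) = (S 0 / (3 * r)) ^ 3 * (T - t) ^ (-(3 * (1 - 1 / r))) := by
  have h0 : reprc (proj (0 : V3)) = 0 := reprc_proj_of_norm_lt (by rw [norm_zero]; norm_num)
  have hx : ‖reprc (proj (0 : V3))‖ < 1 / 8 := by rw [h0, norm_zero]; norm_num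
  have h := (hcoreρ (proj 0) hx t ht).self_of_nhds
  simp only [lift_apply, h0, smul_zero, norm_zero] at h
  rw [h]
  have hl : 0 < T - t := sub_pos.2 ht.2
  rw [show -(3 * (1 - 1 / r)) = (1 / r - 1) * ((3 : ℕ) : ℝ) by push_cast; ring,
    Real.rpow_mul hl.le, Real.rpow_natCast]
  field_simp

end Rates

end Summit.AtomisticToContinuum.HydrodynamicLimit.Theorems

end
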